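import Mathlib.NumberTheory.LocalField.Basic
import Literature.NumberTheory.GaloisRepresentations.WeilDeligneRep
import Literature.NumberTheory.Automorphic.LParameter
import Literature.NumberTheory.Automorphic.SatakeParametersGL
import Literature.NumberTheory.Automorphic.InfinityType
import HarnessLib

-- provenance: harness21/H21/H21/Statements/Lang/LanglandsParameters.lean @ 5c4ae3e (interim HEAD d8f2665); M5 mechanical rewrite
/-!
# Langlands family (`lang`): L-parameters and algebraic infinity types
(statements **lang.S14**, **lang.S34** — parameter side)

Let `F` be a non-archimedean local field with Weil group `W_F = Literature.WeilGroup F` and let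
`ᴸG = Ĝ ⋊ Γ_F` be an L-group (`Literature.NumberTheory.Automorphic.LGroupData`, prelude item C5).

* **lang.S14** (Borel, *Automorphic L-functions*, Corvallis 1979, §8; Kaletha, *The local
  Langlands conjectures for non-quasi-split groups* (2016), §5; Gross–Reeder, *Duke Math. J.*
  154 (2010), §3).  The inventory item is a *definition*: L-parameters
  `φ : W_F × SL₂(ℂ) → ᴸG` up to `Ĝ`-conjugacy, bounded / discrete / unramified parameters,
  enhanced parameters `(φ, ρ)` with `ρ ∈ Irr(π₀(S_φ))`.  These are the prelude declarations
  `LParameter`, `LParameter.setoid`, `IsBounded`, `IsDiscrete`, `IsUnramified`,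
  `componentGroup`, `EnhancedLParameter`.  Here the definitional targets are restated, with the
  bold id, as the standard sanity facts for `G = GL_n`:
  L-parameters of `GL_n` are Frobenius-semisimple Weil–Deligne representations
  (`lParameter_gl_equiv_weilDeligneRep`); `S_φ` is connected, so enhanced = plain
  (`componentGroup_subsingleton_of_gl`); discreteness means `S_φ = Z(Ĝ)`
  (`isDiscrete_iff_of_gl`); unramified parameters are exactly those given by a semisimple
  conjugacy class `α` (`isUnramified_iff_of_gl`); and such a parameter is bounded (tempered) iff
  `|α_j| = 1` (`isBounded_iff_eigenvalues_norm_one`).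
  **Omitted in v0** (documented in the prelude): relevance of parameters for non-quasi-split
  `G` (Borel §8.2(ii)), and Kaletha's rigid enhancement `π₀(S_φ^+)` (Kaletha 2016, §5.1);
  `EnhancedLParameter` uses `π₀(S_φ)`.
* **lang.S34** (Buzzard–Gee, *The conjectural connections between automorphic representations
  and Galois representations* (2014), Definitions 3.1.1, 5.3.2, 5.3.3; Clozel, *Motifs et formes
  automorphes* (1990), Déf. 1.8, 3.12).  The inventory item has two halves.  The Galois half
  (geometric `ℓ`-adic representations, Hodge–Tate weights; Fontaine–Mazur 1995, §1) is
  `GaloisRep.IsGeometric` of prelude G09 `PAdicHodge` and is only *cited* here.  The automorphic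
  half — L-algebraic and C-algebraic representations via the archimedean parameter on `ℂˣ` — is
  the prelude `InfinityType` (item C15) with `IsLAlgebraic`, `IsCAlgebraic`, `IsRegular`,
  `hodgeTateWeights`; its definitional content is restated as
  `isCAlgebraic_iff_isLAlgebraic_twist`, `hodgeTateWeights_int_of_isLAlgebraic`,
  `isRegular_iff_nodup_hodgeTateWeights`.  The attachment `π ↦ InfinityType` of an infinity type
  to the archimedean component of an automorphic representation needs the archimedean local
  Langlands correspondence (`(𝔤, K)`-modules), tier L, and is deferred.

## Mathlib search

Mathlib (this pin) has `IsNonarchimedeanLocalField`, `Module.End.IsSemisimple`,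
`Subgroup.connectedComponentOfOne`, `NumberField.ComplexEmbedding.conjugate`,
`Multiset.Nodup.of_map`, but no L-groups, L-parameters, Weil–Deligne representations or
infinity types (`rg -i 'L.?parameter'`, `rg -i 'Weil.?Deligne'`, `rg -i 'algebraic.*infinity'`
have no relevant hits).  Everything is stated in terms of the accepted H21 prelude; nothing here
duplicates a Mathlib declaration.

## Design choices

* All declarations live in `namespace Literature.Lang` and `open Literature.Automorphic`.
* Restatements that are one-line consequences of prelude declarations are proved
  (`lParameter_gl_equiv_weilDeligneRep`, `componentGroup_subsingleton_of_gl` from the prelude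
  **named facts** `LParameter.gl_equiv_weilDeligneRep`,
  `LParameter.componentGroup_subsingleton_of_gl`, taken as hypotheses `(h : …)`; the three
  lang.S34 lemmas from proved prelude lemmas).  `isDiscrete_iff_of_gl`, `isUnramified_iff_of_gl`
  and `isBounded_iff_eigenvalues_norm_one` are known facts (linear algebra in `GL_n(ℂ)`) vendored
  as **named facts** (`def … : Prop`, pending proof; consumers take `(h : isDiscrete_iff_of_gl F n)`
  etc.), this file being `sorry`-free.  The elementary directions / ingredients that are cheap are
  proved next to them: `isSemisimple_φ_of_gl` (Frobenius-semisimplicity of every `φ(w)` for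
  `GL_n`, from the `LParameter` axiom since the Galois action is trivial) and
  `isUnramified_of_isUnramifiedWith` (the easy direction of `isUnramified_iff_of_gl`).
* `isUnramified_iff_of_gl` uses `LParameter.IsUnramifiedWith φ α` of prelude item C7 (the
  unramified parameter whose Frobenius class is the semisimple class with eigenvalues `α`); the
  non-trivial direction is that Frobenius-semisimplicity (built into `LParameter`) makes `φ(Frob)`
  diagonalisable.
-/

noncomputable section

open scoped MatrixGroups

namespace Literature.NumberTheory.Automorphic


/-! ## lang.S14: L-parameters, the case of `GL_n` -/

section LParameter

variable (F : Type*) [Field F] [ValuativeRel F] [TopologicalSpace F] [IsNonarchimedeanLocalField F]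

/-- **lang.S14** (Borel, Corvallis 1979, §8.2; Gross–Reeder, Duke Math. J. 154 (2010), §2,
Prop. 2.2; Deligne, Antwerp II (1973), §8; Kaletha 2016, §5.1).
**L-parameters of `GL_n` are Frobenius-semisimple Weil–Deligne representations**: the set
`Φ(GL_n) = {φ : W_F × SL₂(ℂ) → GL_n(ℂ)} / GL_n(ℂ)-conjugacy` (quotient by `LParameter.setoid`)
is in bijection with the set of isomorphism classes of Frobenius-semisimple `n`-dimensional
complex Weil–Deligne representations of `W_F` (quotient by `frobSemisimpleWDSetoid`).  Only the
existence of a bijection is asserted (v0; the canonical map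
`(ρ, θ) ↦ (ρ ⊗ θ(diag(‖w‖^{1/2}, ‖w‖^{-1/2})), dθ(e))` is not constructed).  Restates
the prelude named fact `LParameter.gl_equiv_weilDeligneRep` (hypothesis `h`). [cite: Corvallis1979, §8.2] -/
theorem lParameter_gl_equiv_weilDeligneRep (n : ℕ) (h : LParameter.gl_equiv_weilDeligneRep F n) :
    Nonempty (Quotient (LParameter.setoid (LGroupData.gl F n)) ≃
      Quotient (frobSemisimpleWDSetoid F n)) :=
  h

variable {F} {n : ℕ}

/-- **lang.S14** (Gross–Reeder, Duke Math. J. 154 (2010), §3.2; Kaletha 2016, §5.1, Example;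
Borel, Corvallis 1979, §8.2).  For `GL_n` the component group `π₀(S_φ)` of the centralizer of
any L-parameter is trivial (`S_φ` is a product of general linear groups, hence connected), so
enhanced L-parameters `(φ, ρ)` of `GL_n` are the same as plain L-parameters.  Restates
the prelude named fact `LParameter.componentGroup_subsingleton_of_gl` (hypothesis `h`).
[cite: Kaletha2016, §5.1  Example] -/
theorem componentGroup_subsingleton_of_gl (h : LParameter.componentGroup_subsingleton_of_gl F n)
    (φ : LParameter (LGroupData.gl F n)) : Subsingleton φ.componentGroup :=
  h φ

/-- For `GL_n` (trivial Galois action on `Ĝ = GL_n(ℂ)`) the Frobenius-semisimplicity axiom of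
`LParameter` says that `φ(w) ∈ GL_n(ℂ)` is a semisimple endomorphism of `ℂⁿ` for *every*
`w ∈ W_F` (take `m = 1`).  Ref: Borel, Corvallis 1979, §8.2; Gross–Reeder, Duke Math. J. 154
(2010), §2. [folklore] -/
theorem isSemisimple_φ_of_gl (φ : LParameter (LGroupData.gl F n)) (w : GaloisRepresentations.WeilGroup F) :
    Module.End.IsSemisimple (Matrix.toLin'
      (((φ.φ w).left : GL (Fin (LGroupData.gl F n).rank) ℂ) :
        Matrix (Fin (LGroupData.gl F n).rank) (Fin (LGroupData.gl F n).rank) ℂ)) := by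
  simpa using φ.frobSemisimple w 1 one_pos rfl

variable (F) in
/-- **lang.S14** (Gross–Reeder, Duke Math. J. 154 (2010), §3.2; Kaletha 2016, §5.1; Borel,
Corvallis 1979, §10.3(3)).  For `GL_n` (`Ĝ = GL_n(ℂ)`, trivial Galois action, so
`Z(Ĝ)^Γ = Z(GL_n(ℂ)) = ℂˣ`), an L-parameter `φ` is **discrete** (`S_φ / Z(Ĝ)^Γ` finite) iff its
centralizer is exactly the centre, `S_φ = Z(Ĝ)^Γ`: indeed `S_φ` is a connected product of
general linear groups containing the scalars, so `S_φ / ℂˣ` is finite only if it is trivial.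
(Equivalently the associated Weil–Deligne representation is indecomposable.)  Named fact
(a `Prop`, pending proof; consumers take `(h : isDiscrete_iff_of_gl F n)`). [cite: Kaletha2016, §5.1] -/
def isDiscrete_iff_of_gl (n : ℕ) : Prop :=
  ∀ φ : LParameter (LGroupData.gl F n),
    φ.IsDiscrete ↔ φ.centralizerGroup = (LGroupData.gl F n).centerFixed

variable (F) in
/-- **lang.S14** (Borel, Corvallis 1979, §§8.2, 9.5, 10.4; Gross–Reeder, Duke Math. J. 154
(2010), §3.1).  For `GL_n`, an L-parameter `φ` is **unramified** (trivial on inertia, trivial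
`SL₂`) iff it is unramified with Frobenius eigenvalues `α` for some multiset `α`
(`LParameter.IsUnramifiedWith`, prelude item C7), i.e. iff `φ(Frob)` is a semisimple element of
`GL_n(ℂ)` with eigenvalues `α`; the forward direction is Frobenius-semisimplicity of `φ`
(diagonalisability of semisimple complex matrices).  Thus unramified parameters of `GL_n` are
semisimple conjugacy classes in `GL_n(ℂ)`, matching unramified representations via their Satake
parameters.  Named fact (a `Prop`, pending proof; consumers take
`(h : isUnramified_iff_of_gl F n)`); the elementary direction is
`isUnramified_of_isUnramifiedWith` below. [cite: Corvallis1979, §§8.2  9.5  10.4] -/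
def isUnramified_iff_of_gl (n : ℕ) : Prop :=
  ∀ φ : LParameter (LGroupData.gl F n), φ.IsUnramified ↔ ∃ α : Multiset ℂ, φ.IsUnramifiedWith α

/-- The elementary direction of `isUnramified_iff_of_gl`: a parameter of `GL_n` unramified with
some multiset of Frobenius eigenvalues is unramified. [folklore] -/
theorem isUnramified_of_isUnramifiedWith {φ : LParameter (LGroupData.gl F n)}
    (h : ∃ α : Multiset ℂ, φ.IsUnramifiedWith α) : φ.IsUnramified := by
  obtain ⟨α, hα⟩ := h
  exact hα.isUnramified

variable (F) in
/-- **lang.S14** (Borel, Corvallis 1979, §10.3(4) and §10.4; Gross–Reeder, Duke Math. J. 154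
(2010), §3.2).  An unramified L-parameter of `GL_n` with Frobenius eigenvalues `α` is
**bounded** (tempered: `φ(W_F)` relatively compact in `GL_n(ℂ)`) iff all eigenvalues have
absolute value `1`: `φ(W_F)` is the cyclic group generated by the semisimple matrix `φ(Frob)`,
which is relatively compact iff its eigenvalues lie on the unit circle.  Compare
`isTempered_iff_forall_norm_eq_one` (prelude C7) on the representation side.  Named fact
(a `Prop`, pending proof; consumers take `(h : isBounded_iff_eigenvalues_norm_one F n)`).
[cite: Corvallis1979, §10.3(4)] -/
def isBounded_iff_eigenvalues_norm_one (n : ℕ) : Prop :=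
  ∀ ⦃φ : LParameter (LGroupData.gl F n)⦄ ⦃α : Multiset ℂ⦄, φ.IsUnramifiedWith α →
    (φ.IsBounded ↔ ∀ a ∈ α, ‖a‖ = 1)

end LParameter

/-! ## lang.S34: algebraic infinity types (automorphic half) -/

section InfinityType

variable {K : Type*} [Field K] {n : ℕ}

/-- **lang.S34** (Buzzard–Gee 2014, Definitions 3.1.1, 5.3.2, 5.3.3 and the discussion following
5.3.3; Clozel 1990, Déf. 1.8).  An infinity type `T` for `GL_n / K` is **C-algebraic** (all
archimedean exponents in `(n-1)/2 + ℤ`; Clozel's *algébrique*) iff its twist by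
`|det|^{(n-1)/2}` is **L-algebraic** (all exponents in `ℤ`).  This is the definitional content
of lang.S34 on the automorphic side; the attachment `π ↦ InfinityType` (archimedean local
Langlands) is tier L and deferred.  Restates `InfinityType.isCAlgebraic_iff_isLAlgebraic_twist`
(prelude C15). [cite: BuzzardGee2014, Definitions 3.1.1  5.3.2  5.3.3 and the] -/
theorem isCAlgebraic_iff_isLAlgebraic_twist (T : InfinityType K n) :
    T.IsCAlgebraic ↔ (T.twist (((n : ℂ) - 1) / 2)).IsLAlgebraic :=
  InfinityType.isCAlgebraic_iff_isLAlgebraic_twist T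

/-- **lang.S34** (Buzzard–Gee 2014, Definition 3.1.1, Remark 3.1.3 and Conjecture 3.2.2).  The
(expected) Hodge–Tate weights `-a` of an **L-algebraic** infinity type are integers, as required
for the Galois representation conjecturally attached to an L-algebraic `π` (whose Hodge–Tate
weights are these integers; Galois half: `GaloisRep.IsGeometric`, prelude G09 `PAdicHodge`,
cited only).  Definitional content of lang.S34 on the automorphic side; the attachment
`π ↦ InfinityType` is tier L and deferred.  Restates
`InfinityType.hodgeTateWeights_mem_int_of_isLAlgebraic` (prelude C15). [cite: BuzzardGee2014, Definition 3.1.1  Remark 3.1.3 and Conje] -/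
theorem hodgeTateWeights_int_of_isLAlgebraic {T : InfinityType K n} (hT : T.IsLAlgebraic)
    (σ : K →+* ℂ) {w : ℂ} (hw : w ∈ T.hodgeTateWeights σ) : ∃ m : ℤ, w = m :=
  InfinityType.hodgeTateWeights_mem_int_of_isLAlgebraic hT σ hw

/-- **lang.S34** (Clozel 1990, Déf. 3.12; Buzzard–Gee 2014, §3.1).  An infinity type is
**regular** (pairwise distinct exponents `a` at every complex embedding) iff its multiset of
Hodge–Tate weights at every embedding has no repetition (the weights are `-a`).  Definitional
content of lang.S34 on the automorphic side ("regular algebraic"); the attachment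
`π ↦ InfinityType` is tier L and deferred.  The forward direction is
`InfinityType.IsRegular.nodup_hodgeTateWeights` (prelude C15). [cite: Clozel1990, Déf. 3.12] -/
theorem isRegular_iff_nodup_hodgeTateWeights (T : InfinityType K n) :
    T.IsRegular ↔ ∀ σ : K →+* ℂ, (T.hodgeTateWeights σ).Nodup := by
  refine ⟨fun hT σ => hT.nodup_hodgeTateWeights σ, fun h σ => ?_⟩
  have h' : T.hodgeTateWeights σ = ((T σ).map ArchWeight.a).map Neg.neg := by
    simp [InfinityType.hodgeTateWeights, Multiset.map_map]
  exact Multiset.Nodup.of_map _ (h' ▸ h σ)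

end InfinityType

end Literature.NumberTheory.Automorphic
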